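import Summits.QuantumFields.BalabanUV.T4Continuum.Spine.NE2.CovariantTableAveraging

/-!
# T⁴ programme, spine node NE2 (U1a) — R14 W2, file 1: BAŁABAN's COMPOSED AVERAGING AS A TRANSPORTER TABLE `T_Bal` (definition, flat case, size law)
# (cell `pub-balaban-gaps`, seat ne2 gen 3; plan `ne/NE2-R14-PLAN.md` W2 / STATUS v2)

Print's averaging in [B9] (3.15) p. 393 is the COMPOSITION `Q_k(U) = Q(Ū^{(k−1)}) ⋯ Q(Ū)Q(U)` of [B7] (15)/(125)-type one-step bond-line averagings
`(Q(V)A)_μ(y′) = L^{−(d+1)} Σ_{x∈B_L(y′)} Σ_{s<L} R(V; L y′ → x, s)·A_μ(x + s e_μ)`, the `i`-th step transporting with the `(k−i)`-fold AVERAGED field read on level `i`.  In the FLAT case the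
k-fold composition IS the model's `(1.18)` averaging `QvOp (lev L k)` (generating functions: `Π_i ((1 − x^{L^{k−i+1}})/(1 − x^{L^{k−i}}))² = ((1 − x^{L^k})/(1 − x))²`), and the base-`L`
digits `(j_i, s_i)` of the pair `(j, t)` of `CovariantTableAveraging.QcovT` biject with the step offsets.  Hence the composed averaging is represented (by design; the operator identity is NOT proved here beyond the flat case) as `QcovT (lev L k) M (TBal W k)` for the TABLE
  `TBal W k y j μ t = Π_{i=1}^{k} transport (W i) μ (contour at level i from L·z_{i−1} by the digits j_i, then s_i steps along μ)`,
`z_i` = the level-`i` bond base with natural coordinates `c_i = ⌊j/L^{k−i}⌋ + [·=μ]⌊t/L^{k−i}⌋` over the unit base `y` (**`TBal`**, with `lpt`, `contourFrom`, `digit`).  The averaged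
fields are DATA `W : ℕ → Fin d → idx L M i → Matrix o o ℂ` (in the intended reading `W i = Ad Ū^{(k−i)}`; [B7] (15)'s `Ū = exp(Q log-lift)` is untyped — DIVERGENCE F6 (ζ) — so nothing
of it is constructed).  Proved here: **`TBal_one`** (trivial fields give the trivial table, so `QcovT (TBal 1 k) = Q_k ⊗ 1` by `QcovT_const_one`), **`norm_TBal_sub_one_le`** (the size datum
`hTτ` of `CovariantTableTower.tierB_table_rate_at_one` from per-bond sizes `‖W i − 1‖ ≤ a_i`: `‖TBal − 1‖ ≤ Π_i (1 + a_i)^{(d+1)L} − 1`).  NOT here (successor, W2 file 2): the two-level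
consistency datum `hT2` of `TBal` (from node NE3's consistency of the averaged fields between the level-`k` and level-`(k+1)` problems + one finest step), and W3.
HONEST FRAMING (T4-DAG p. 1).  A DEFINITION on the tree's finite tori + two pieces of bookkeeping; `W` DATA; NOT an assertion that Bałaban's `Q_k(U)` equals anything of the model beyond
the flat case; NOT NE2, NOT [B9] (3.16)/(3.26) as printed; NE2 (U1a) NOT PROVED; spine PROVED 0/9 unchanged; NOT continuum YM / infinite volume / mass gap / Clay.  HONEST DEPENDENCY:
continuum YM on T⁴ ⇐ BetaPertH ∧ nine spine estimates (0/9 proved); BetaPertH ⇐ (D1) ∧ (D4) ∧ CAP+tail; G-an2-4 gates asym, D1 and NE2/3/4.  No `sorry`.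
-/

noncomputable section

open scoped BigOperators ComplexConjugate Matrix Matrix.Norms.L2Operator Kronecker

namespace Summit.QuantumFields.BalabanUV.T4Continuum.NE2.CovariantTableBalaban

open Literature.MathematicalPhysics.QuantumFieldTheory.Balaban1983to89.B5Prop11Plancherel (Tor fine unitVec)
open Literature.MathematicalPhysics.QuantumFieldTheory.Balaban1983to89.B5Block118 (QvOp bpt tstep up)
open Literature.MathematicalPhysics.QuantumFieldTheory.Balaban1983to89.B5G183RateUnitTower (lev lev_neZero)
open Summit.QuantumFields.BalabanUV.T4Continuum.BalabanAveragedTowerUnit (idx)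
open Summit.QuantumFields.BalabanUV.T4Continuum.CovariantBlockAveraging (transport transport_one norm_transport_sub_one_le leg length_leg norm_listProd_sub_one_le)
open Summit.QuantumFields.BalabanUV.T4Continuum.NE2.CovariantTableAveraging (Table QcovT QcovT_const_one norm_mul_sub_one_le)

variable {d : ℕ} (L : ℕ) [NeZero L] (M : Fin d → ℕ) [hM : ∀ μ, NeZero (M μ)] {o : Type*} [Fintype o] [DecidableEq o]

/-! ## §1 Geometry: points over the unit base, contours from an arbitrary point, base-`L` digits -/

/-- the point of the level-`i` torus with natural coordinates `c` over the unit base `y`: `L^i·y + c`. [folklore] -/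
def lpt (i : ℕ) (y : Tor M) (c : Fin d → ℕ) : Tor (fine (lev L i) M) :=
  up (lev L i) M y + fun ν => ((c ν : ℕ) : ZMod (fine (lev L i) M ν))

/-- Bałaban's one-step contour [B7] (9) started at an ARBITRARY point `z`: legs along the axes `0, …, d−1` by `r_ν` steps, then `s` steps along `μ`. [folklore] -/
def contourFrom (N : ℕ) [NeZero N] (z : Tor (fine N M)) (r : Fin d → ℕ) (μ : Fin d) (s : ℕ) : List (Tor (fine N M) × Fin d) :=
  ((List.finRange d).flatMap fun ν => leg N M ν (z + fun κ => if κ < ν then ((r κ : ℕ) : ZMod (fine N M κ)) else 0) (r ν))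
    ++ leg N M μ (z + fun κ => ((r κ : ℕ) : ZMod (fine N M κ))) s

omit hM in
/-- length of the one-step contour: `Σ_ν r_ν + s`. [folklore] -/
theorem length_contourFrom (N : ℕ) [NeZero N] (z : Tor (fine N M)) (r : Fin d → ℕ) (μ : Fin d) (s : ℕ) :
    (contourFrom M N z r μ s).length = (∑ ν, r ν) + s := by
  rw [contourFrom, List.length_append, List.length_flatMap, length_leg]
  congr 1
  simp only [length_leg]
  rw [← List.sum_toFinset _ (List.nodup_finRange d)]
  simp

/-- the `m`-th base-`L` digit of `a`. [folklore] -/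
def digit (m a : ℕ) : ℕ := (a / L ^ m) % L

omit [NeZero L] in
/-- digits are `< L` (for `L ≠ 0`). [folklore] -/
theorem digit_lt (hL : 0 < L) (m a : ℕ) : digit L m a < L := Nat.mod_lt _ hL

/-! ## §2 The composed table -/

/-- natural coordinates of the level-`i` bond base `z_i` of the fine pair `(j, t)` in direction `μ` (level `k`): `c_i ν = ⌊j_ν/L^{k−i}⌋ + [ν = μ]·⌊t/L^{k−i}⌋`. [folklore] -/
def coordAt (k i : ℕ) (j : Fin d → ℕ) (μ : Fin d) (t : ℕ) : Fin d → ℕ :=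
  fun ν => j ν / L ^ (k - i) + if ν = μ then t / L ^ (k - i) else 0

/-- the `i`-th STEP TRANSPORTER (level `i`, `1 ≤ i ≤ k`): transport of the averaged field `W i` along the one-step contour from `L·z_{i−1}` by the digits `j_i`, then `s_i` steps
along `μ`. [cite: Balaban1985Averaging, (9) p.18, (15) p.19, (125) p.36 (shape)] [folklore] -/
def stepT (W : (i : ℕ) → Fin d → (idx L M i → Matrix o o ℂ)) (k : ℕ) (y : Tor M) (j : Fin d → ℕ) (μ : Fin d) (t : ℕ) (i : ℕ) : Matrix o o ℂ :=
  haveI := lev_neZero L i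
  transport (fine (lev L i) M) (W i) μ
    (contourFrom M (lev L i) (lpt L M i y (fun ν => L * coordAt L k (i - 1) j μ t ν))
      (fun ν => digit L (k - i) (j ν)) μ (digit L (k - i) t))

/-- **BAŁABAN's COMPOSED AVERAGING AS A TRANSPORTER TABLE**: `TBal W k y j μ t = Π_{i=1}^{k} stepT W k y j μ t i` (coarsest step leftmost) — DESIGNED so that, by the digit bijection
and the flat generating-function identity, `QcovT (lev L k) M (TBal W k)` represents the k-fold composition `Q(W 1)⋯Q(W k)` of (15)-type one-step covariant averagings (the
composition IDENTITY itself is NOT proved in this file — only its flat case `QcovT_TBal_one`; W2 file 2).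
[cite: Balaban1985BackgroundPropagators, (3.14)–(3.15) p.393; Balaban1985Averaging, (15) p.19, (125) p.36 (shape)] [folklore] -/
def TBal (W : (i : ℕ) → Fin d → (idx L M i → Matrix o o ℂ)) (k : ℕ) : Table d (lev L k) M o :=
  fun y j μ t => ((List.range k).map fun i' => stepT L M W k y (fun ν => (j ν : ℕ)) μ t (i' + 1)).prod

/-! ## §3 Flat case and size law -/

omit hM in
/-- **TRIVIAL FIELDS GIVE THE TRIVIAL TABLE** (hence `QcovT (TBal 1 k) = Q_k ⊗ 1` by `QcovT_const_one`: the flat composed averaging is the model's (1.18)). [folklore] -/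
theorem TBal_one (k : ℕ) : TBal L M (fun _ _ _ => (1 : Matrix o o ℂ)) k = fun _ _ _ _ => 1 := by
  funext y j μ t
  rw [TBal]
  have h : ∀ i' ∈ List.range k, stepT L M (fun _ _ _ => (1 : Matrix o o ℂ)) k y (fun ν => (j ν : ℕ)) μ t (i' + 1) = 1 := fun i' _ => by
    rw [stepT]; exact transport_one _ _ _
  rw [List.map_congr_left h, List.map_const', List.prod_replicate, one_pow]

omit hM in
/-- the flat composed averaging is `Q_k ⊗ 1`. [folklore] -/
theorem QcovT_TBal_one (k : ℕ) : QcovT (lev L k) M (TBal L M (fun _ _ _ => (1 : Matrix o o ℂ)) k) = QvOp (lev L k) M ⊗ₖ (1 : Matrix o o ℂ) := by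
  rw [TBal_one, QcovT_const_one]

omit hM in
/-- **SIZE OF A STEP**: `‖stepT − 1‖ ≤ (1 + a_i)^{(d+1)L} − 1` from `‖W i − 1‖ ≤ a_i` per bond (the contour has `≤ (d+1)·L` bonds: digits `< L`). [folklore] -/
theorem norm_stepT_sub_one_le {W : (i : ℕ) → Fin d → (idx L M i → Matrix o o ℂ)} {a : ℕ → ℝ} (ha : ∀ i, 0 ≤ a i)
    (hW : ∀ i ν b, ‖W i ν b - 1‖ ≤ a i) (k : ℕ) (y : Tor M) (j : Fin d → ℕ) (μ : Fin d) (t : ℕ) (i : ℕ) :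
    ‖stepT L M W k y j μ t i - 1‖ ≤ (1 + a i) ^ ((d + 1) * L) - 1 := by
  haveI := lev_neZero L i
  have hL : 0 < L := Nat.pos_of_ne_zero (NeZero.ne L)
  rw [stepT]
  refine norm_transport_sub_one_le (fine (lev L i) M) (ha i) (hW i) μ ?_
  rw [length_contourFrom]
  calc (∑ ν, digit L (k - i) (j ν)) + digit L (k - i) t ≤ (∑ _ν : Fin d, L) + L :=
        add_le_add (Finset.sum_le_sum fun ν _ => (digit_lt L hL _ _).le) (digit_lt L hL _ _).le
    _ = (d + 1) * L := by rw [Finset.sum_const, Finset.card_univ, Fintype.card_fin, smul_eq_mul]; ring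

omit hM in
/-- products of step transporters: `‖Π_{i∈l} step_i − 1‖ ≤ Π_{i∈l}(1 + a_i)^{(d+1)L} − 1`. [folklore] -/
theorem norm_prod_stepT_sub_one_le {W : (i : ℕ) → Fin d → (idx L M i → Matrix o o ℂ)} {a : ℕ → ℝ} (ha : ∀ i, 0 ≤ a i)
    (hW : ∀ i ν b, ‖W i ν b - 1‖ ≤ a i) (k : ℕ) (y : Tor M) (j : Fin d → ℕ) (μ : Fin d) (t : ℕ) (l : List ℕ) :
    ‖(l.map fun i' => stepT L M W k y j μ t (i' + 1)).prod - 1‖ ≤ (l.map fun i' => (1 + a (i' + 1)) ^ ((d + 1) * L)).prod - 1 := by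
  induction l with
  | nil => simp
  | cons i' l ih =>
    rw [List.map_cons, List.prod_cons, List.map_cons, List.prod_cons]
    exact (norm_mul_sub_one_le (norm_stepT_sub_one_le L M ha hW k y j μ t (i' + 1)) ih).trans (le_of_eq (by ring))

omit hM in
/-- **THE SIZE DATUM `hTτ` OF THE COMPOSED TABLE**: `‖TBal W k − 1‖ ≤ Π_{i=1}^{k} (1 + a_i)^{(d+1)L} − 1` from per-bond sizes `‖W i − 1‖ ≤ a_i` — for (3.35)-type sizes (`a_i` small
like `(L^iη)`-powers at fine levels) this is `≤ e^{(d+1)LΣa_i} − 1` uniformly in `k`. [folklore] -/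
theorem norm_TBal_sub_one_le {W : (i : ℕ) → Fin d → (idx L M i → Matrix o o ℂ)} {a : ℕ → ℝ} (ha : ∀ i, 0 ≤ a i)
    (hW : ∀ i ν b, ‖W i ν b - 1‖ ≤ a i) (k : ℕ) (y : Tor M) (j : Fin d → Fin (lev L k)) (μ : Fin d) (t : ℕ) :
    ‖TBal L M W k y j μ t - 1‖ ≤ ((List.range k).map fun i' => (1 + a (i' + 1)) ^ ((d + 1) * L)).prod - 1 :=
  norm_prod_stepT_sub_one_le L M ha hW k y (fun ν => (j ν : ℕ)) μ t (List.range k)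

end Summit.QuantumFields.BalabanUV.T4Continuum.NE2.CovariantTableBalaban

end
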